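import Summits.NavierStokesRegularity.NavierStokesRegularity.Theorems.OddMorawetzLocal.Negative.OddMorawetzLocalRefutationDefsV
import Summits.NavierStokesRegularity.NavierStokesRegularity.Theorems.OddMorawetzOddMorawetzLocalCoeffSemantics
import Summits.NavierStokesRegularity.NavierStokesRegularity.Theorems.OddMorawetzOddMorawetzLocalIsoCert
import HarnessLib

/-!
# The block certificates `blockCheck` as a matrix identity mod `p` (crux `OddMorawetzLocal`, refutation)

Stub `certB_mul_eq_one` of the refutation skeleton of the crux
`Summit.NavierStokesRegularity.NavierStokesRegularity.Theses.OddMorawetz.OddMorawetzLocal`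
(item `stmt-NavierStokesRegularity-1376`). Pure list/index bookkeeping over Mathlib; no named facts, no definitions.

The rank certificate of the derivation matrix `aMatrix k reps` is a list of blocks `(rows, cols, inv)`; the kernel
checks say: `blockCheck` — the minor `(rows × cols)` of the derivation matrix times `inv` is the identity mod `p`,
block by block; `blockShapesDisjoint` — a row monomial of one block never has the shape of a column representative
of another block; `colShapePure` — every monomial of a derivation column has the shape of its representative (the
derivation preserves shapes); `certRangesOk` — sizes and index ranges. We prove that the `r × r` minor on the
concatenated rows/columns (`certRows`, `certCols`, read through `certIdx`), reduced mod `p`, has the block-diagonal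
right inverse `certBd blocks p r` assembled by `certInvEntry` — hypothesis `hB` of the landed
`kernel_eq_span_of_modular_certificate`.

Steps (all entrywise, `ℕ`-indexed):
* the landed `IsoCert.matMulMod_entry`, `IsoCert.cast_toNat_emod`, `IsoCert.get_certIdx` (sibling stub
  `isoCert_mul_eq_one`, file `…OddMorawetzLocalIsoCert`) — the list pipeline `isIdentityList (matMulMod …)` read in
  `ZMod p` (the modular fold is the sum; stored residues are the integers; `certIdx` reads in-range entries without
  reduction); `blockCheck_entry` — hence `blockCheck` says `∑ u, minor[a][u] * inv[u][c] = δ a c`;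
* `coeffOf_eq_zero_of_ne` + the two shape checks — the minor entries coupling two distinct blocks vanish;
* `sum_certInvEntry` — for block data with these two properties (abstract entry function `A`), the product of the
  concatenated minor with the `certInvEntry` matrix is the identity: induction on the list of blocks, splitting
  positions and the summation at the size of the head block (`certInvEntry_cons_lt/add`, `Finset.sum_range_add`,
  `List.getD_append(_right)`);
* assembly: `Matrix.mul_apply`, `Finset.sum_range`, and `certIdx` reads in-range entries without reduction.
-/

set_option linter.dupNamespace false
set_option autoImplicit false

namespace Summit.NavierStokesRegularity.NavierStokesRegularity.Theorems.OddMorawetz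

namespace CertBridge

open IsoCert

/-! ### One block certificate read in `ZMod p` -/

/-- **One block certificate, entrywise.** `blockCheck k L reps rs cs inv p = true` (with `cs`, `inv` of the size of
`rs`) says: `∑ u, coeffOf (derP L (orbitSumN reps[cs[u]])) (idx k)[rs[a]] * inv[u][c] = δ a c` in `ZMod p`. -/
theorem blockCheck_entry (k p : ℕ) [Fact p.Prime] (L : Matrix (Fin 3) (Fin 3) ℤ) (reps : List (List JVar))
    (rs cs : List ℕ) (inv : List (List ℕ)) (h : blockCheck k L reps rs cs inv p = true)
    (hcs : cs.length = rs.length) (hinv : inv.length = rs.length) (a c : ℕ) (ha : a < rs.length)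
    (hc : c < rs.length) :
    ∑ u ∈ Finset.range rs.length,
      ((JPoly.coeffOf (JPoly.derP L (orbitSumN (reps.getD (cs.getD u 0) []))) ((idx k).getD (rs.getD a 0) []) : ℤ) :
          ZMod p) * (((inv.getD u []).getD c 0 : ℕ) : ZMod p) = if a = c then 1 else 0 := by
  have hMl : (colsToRows (minorCols k L reps rs cs p) rs.length).length = rs.length := by simp [colsToRows]
  have hBl : (colsToRows inv inv.length).length = rs.length := by simp [colsToRows, hinv]
  have hrow : ∀ row ∈ colsToRows (minorCols k L reps rs cs p) rs.length, row.length = rs.length := by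
    intro row hrow
    simp only [colsToRows, List.mem_map, List.mem_range] at hrow
    obtain ⟨i, -, rfl⟩ := hrow
    simp [minorCols, hcs]
  have hcol : ∀ col ∈ colsToRows inv inv.length, col.length = rs.length := by
    intro col hcol
    simp only [colsToRows, List.mem_map, List.mem_range] at hcol
    obtain ⟨i, -, rfl⟩ := hcol
    simp [hinv]
  rw [← matMulMod_entry _ _ p rs.length rs.length h hMl hBl hrow hcol a c ha hc]
  refine Finset.sum_congr rfl fun u hu => ?_
  have hu : u < rs.length := Finset.mem_range.1 hu
  have hM : ((colsToRows (minorCols k L reps rs cs p) rs.length).getD a []).getD u 0 =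
      Int.toNat ((JPoly.coeffOf (JPoly.derP L (orbitSumN (reps.getD (cs.getD u 0) [])))
        ((idx k).getD (rs.getD a 0) [])) % (p : ℤ)) := by
    rw [List.getD_eq_getElem _ [] (by rw [hMl]; exact ha)]
    simp only [colsToRows, List.getElem_map, List.getElem_range]
    rw [List.getD_eq_getElem _ (0 : ℕ) (by simp [minorCols, hcs, hu]), List.getElem_map]
    simp only [minorCols, List.getElem_map]
    rw [List.getD_eq_getElem _ (0 : ℕ) (by simp [ha]), List.getElem_map, List.getD_eq_getElem cs 0 (by omega),
      List.getD_eq_getElem rs 0 ha]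
  have hB : ((colsToRows inv inv.length).getD c []).getD u 0 = (inv.getD u []).getD c 0 := by
    rw [List.getD_eq_getElem _ [] (by rw [hBl]; exact hc)]
    simp only [colsToRows, List.getElem_map, List.getElem_range]
    rw [List.getD_eq_getElem _ (0 : ℕ) (by simp; omega), List.getElem_map,
      List.getD_eq_getElem inv [] (by omega)]
  rw [hM, hB, cast_toNat_emod]

/-! ### Vanishing coefficients and the block structure -/

/-- A coefficient at a monomial that does not occur is `0`. -/
theorem coeffOf_eq_zero_of_ne (q : JPoly ℤ) (m : List JVar) (h : ∀ tm ∈ q, tm.2 ≠ m) : JPoly.coeffOf q m = 0 := by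
  unfold JPoly.coeffOf
  rw [List.filter_eq_nil_iff.2]
  · rfl
  · intro tm htm
    simpa using h tm htm

/-- Under "one column per row", the concatenated columns are as many as the concatenated rows. -/
theorem length_certCols_eq : ∀ (blocks : List (List ℕ × List ℕ × List (List ℕ))),
    (∀ b ∈ blocks, b.2.1.length = b.1.length) → (certCols blocks).length = (certRows blocks).length
  | [], _ => rfl
  | b :: bs, h => by
    have e1 : certCols (b :: bs) = b.2.1 ++ certCols bs := rfl
    have e2 : certRows (b :: bs) = b.1 ++ certRows bs := rfl
    rw [e1, e2, List.length_append, List.length_append, h b List.mem_cons_self,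
      length_certCols_eq bs fun b' hb' => h b' (List.mem_cons_of_mem _ hb')]

/-- `certInvEntry` at a row of the head block: the head inverse block, or `0` right of it. -/
theorem certInvEntry_cons_lt (rs cs : List ℕ) (inv : List (List ℕ)) (bs : List (List ℕ × List ℕ × List (List ℕ)))
    (u t : ℕ) (hu : u < rs.length) :
    certInvEntry ((rs, cs, inv) :: bs) u t = if t < rs.length then (inv.getD u []).getD t 0 else 0 := by
  simp [certInvEntry, hu]

/-- `certInvEntry` at a row below the head block: `0` under the head block, the tail matrix right of it. -/
theorem certInvEntry_cons_add (rs cs : List ℕ) (inv : List (List ℕ))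
    (bs : List (List ℕ × List ℕ × List (List ℕ))) (u t : ℕ) :
    certInvEntry ((rs, cs, inv) :: bs) (rs.length + u) t =
      if t < rs.length then 0 else certInvEntry bs u (t - rs.length) := by
  simp [certInvEntry]

/-- **The block-diagonal product, abstractly.** For block data whose blocks satisfy the entrywise inverse identity
for an entry function `A` and whose cross-block entries of `A` vanish, the concatenated minor times the
`certInvEntry` matrix is the identity (induction on the blocks, splitting at the size of the head block). -/
theorem sum_certInvEntry {R : Type} [CommRing R] (A : ℕ → ℕ → R) :
    ∀ (blocks : List (List ℕ × List ℕ × List (List ℕ))),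
    (∀ b ∈ blocks, b.2.1.length = b.1.length) →
    (∀ b ∈ blocks, ∀ a c : ℕ, a < b.1.length → c < b.1.length →
      ∑ u ∈ Finset.range b.1.length, A (b.1.getD a 0) (b.2.1.getD u 0) * (((b.2.2.getD u []).getD c 0 : ℕ) : R) =
        if a = c then 1 else 0) →
    blocks.Pairwise (fun b b' => (∀ i ∈ b.1, ∀ c ∈ b'.2.1, A i c = 0) ∧ (∀ i ∈ b'.1, ∀ c ∈ b.2.1, A i c = 0)) →
    ∀ s t : ℕ, s < (certRows blocks).length → t < (certRows blocks).length →
      ∑ u ∈ Finset.range (certRows blocks).length,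
        A ((certRows blocks).getD s 0) ((certCols blocks).getD u 0) * ((certInvEntry blocks u t : ℕ) : R) =
        if s = t then 1 else 0
  | [], _, _, _, s, _, hs, _ => absurd hs (Nat.not_lt_zero _)
  | (rs, cs, inv) :: bs, hlen, hblk, hpw, s, t, hs, ht => by
    rw [List.pairwise_cons] at hpw
    obtain ⟨hb, hpw'⟩ := hpw
    have hlen' : ∀ b' ∈ bs, b'.2.1.length = b'.1.length := fun b' hb' => hlen b' (List.mem_cons_of_mem _ hb')
    have ih := sum_certInvEntry A bs hlen' (fun b' hb' => hblk b' (List.mem_cons_of_mem _ hb')) hpw'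
    have hcl : cs.length = rs.length := hlen _ List.mem_cons_self
    have hrows : certRows ((rs, cs, inv) :: bs) = rs ++ certRows bs := rfl
    have hcols : certCols ((rs, cs, inv) :: bs) = cs ++ certCols bs := rfl
    have hRC : (certCols bs).length = (certRows bs).length := length_certCols_eq bs hlen'
    rw [hrows, List.length_append] at hs ht
    rw [hrows, hcols, List.length_append, Finset.sum_range_add]
    -- the two partial sums
    have S1 : ∑ u ∈ Finset.range rs.length, A ((rs ++ certRows bs).getD s 0) ((cs ++ certCols bs).getD u 0) *
        ((certInvEntry ((rs, cs, inv) :: bs) u t : ℕ) : R) =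
        if t < rs.length then ∑ u ∈ Finset.range rs.length,
          A ((rs ++ certRows bs).getD s 0) (cs.getD u 0) * (((inv.getD u []).getD t 0 : ℕ) : R) else 0 := by
      split_ifs with htn
      · refine Finset.sum_congr rfl fun u hu => ?_
        have hu' : u < rs.length := Finset.mem_range.1 hu
        rw [List.getD_append cs (certCols bs) 0 u (by omega), certInvEntry_cons_lt _ _ _ _ _ _ hu', if_pos htn]
      · refine Finset.sum_eq_zero fun u hu => ?_
        have hu' : u < rs.length := Finset.mem_range.1 hu
        rw [certInvEntry_cons_lt _ _ _ _ _ _ hu', if_neg htn, Nat.cast_zero, mul_zero]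
    have S2 : ∑ u ∈ Finset.range (certRows bs).length, A ((rs ++ certRows bs).getD s 0)
        ((cs ++ certCols bs).getD (rs.length + u) 0) *
        ((certInvEntry ((rs, cs, inv) :: bs) (rs.length + u) t : ℕ) : R) =
        if t < rs.length then 0 else ∑ u ∈ Finset.range (certRows bs).length,
          A ((rs ++ certRows bs).getD s 0) ((certCols bs).getD u 0) *
            ((certInvEntry bs u (t - rs.length) : ℕ) : R) := by
      split_ifs with htn
      · refine Finset.sum_eq_zero fun u _ => ?_
        rw [certInvEntry_cons_add, if_pos htn, Nat.cast_zero, mul_zero]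
      · refine Finset.sum_congr rfl fun u _ => ?_
        rw [List.getD_append_right cs (certCols bs) 0 (rs.length + u) (by omega), hcl, Nat.add_sub_cancel_left,
          certInvEntry_cons_add, if_neg htn]
    rw [S1, S2]
    by_cases hsn : s < rs.length
    · rw [List.getD_append rs (certRows bs) 0 s hsn]
      by_cases htn : t < rs.length
      · rw [if_pos htn, if_pos htn, add_zero]
        exact hblk _ List.mem_cons_self s t hsn htn
      · rw [if_neg htn, if_neg htn, zero_add, if_neg (by omega)]
        refine Finset.sum_eq_zero fun u hu => ?_
        have hu' : u < (certCols bs).length := by rw [hRC]; exact Finset.mem_range.1 hu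
        have hmem : (certCols bs).getD u 0 ∈ certCols bs := by
          rw [List.getD_eq_getElem _ _ hu']
          exact List.getElem_mem _
        obtain ⟨b', hb', hc⟩ := List.mem_flatMap.1 hmem
        have hi : rs.getD s 0 ∈ rs := by
          rw [List.getD_eq_getElem _ _ hsn]
          exact List.getElem_mem _
        rw [(hb b' hb').1 _ hi _ hc, zero_mul]
    · rw [List.getD_append_right rs (certRows bs) 0 s (by omega)]
      have hs' : s - rs.length < (certRows bs).length := by omega
      have hi : (certRows bs).getD (s - rs.length) 0 ∈ certRows bs := by
        rw [List.getD_eq_getElem _ _ hs']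
        exact List.getElem_mem _
      obtain ⟨b', hb', hib⟩ := List.mem_flatMap.1 hi
      by_cases htn : t < rs.length
      · rw [if_pos htn, if_pos htn, add_zero, if_neg (by omega)]
        refine Finset.sum_eq_zero fun u hu => ?_
        have hu' : u < cs.length := by rw [hcl]; exact Finset.mem_range.1 hu
        have hc : cs.getD u 0 ∈ cs := by
          rw [List.getD_eq_getElem _ _ hu']
          exact List.getElem_mem _
        rw [(hb b' hb').2 _ hib _ hc, zero_mul]
      · rw [if_neg htn, if_neg htn, zero_add, ih _ _ hs' (by omega)]
        by_cases hst : s = t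
        · subst hst; simp
        · rw [if_neg hst, if_neg (by omega)]

end CertBridge

open CertBridge IsoCert

/-- **Stub `certB_mul_eq_one` of crux `OddMorawetzLocal` (refutation).** If every block certificate is accepted
by `blockCheck`, the blocks are shape-disjoint (`blockShapesDisjoint`), the derivation columns are shape-pure
(`colShapePure`) and the ranges are as checked by `certRangesOk`, then the `r × r` minor of the derivation matrix
`aMatrix k reps` on the concatenated certificate rows/columns, reduced mod `p`, has the block-diagonal right
inverse `certBd blocks p r`. -/
theorem certB_mul_eq_one (k : ℕ) (reps : List (List JVar)) (blocks : List (List ℕ × List ℕ × List (List ℕ)))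
    (kcols : List ℕ) (cinv : List (List ℕ)) (d p r : ℕ) [Fact p.Prime]
    (hblk : ∀ β, β < blocks.length →
      blockCheck k lieZ reps (blocks.getD β ([], [], [])).1 (blocks.getD β ([], [], [])).2.1
        (blocks.getD β ([], [], [])).2.2 p = true)
    (hdisj : blockShapesDisjoint k reps blocks = true)
    (hpure : colShapePure reps (certCols blocks) = true)
    (hrng : certRangesOk k reps blocks kcols cinv d = true)
    (hr : (certRows blocks).length = r)
    (hI : 0 < (idx k).length) (hJ : 0 < reps.length) :
    (((aMatrix k reps).submatrix (certIdx (certRows blocks) (idx k).length r hI)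
        (certIdx (certCols blocks) reps.length r hJ)).map (Int.cast : ℤ → ZMod p)) * certBd blocks p r = 1 := by
  subst hr
  -- the checked ranges
  unfold certRangesOk at hrng
  simp only [Bool.and_eq_true, List.all_eq_true, decide_eq_true_eq] at hrng
  obtain ⟨⟨⟨⟨hblocks, -⟩, -⟩, -⟩, -⟩ := hrng
  have hlen : ∀ b ∈ blocks, b.2.1.length = b.1.length := fun b hb => (hblocks b hb).1.1.2
  -- the entry function of the minor
  obtain ⟨A, hA⟩ : ∃ A : ℕ → ℕ → ZMod p, ∀ i c, A i c =
      ((JPoly.coeffOf (JPoly.derP lieZ (orbitSumN (reps.getD c []))) ((idx k).getD i []) : ℤ) : ZMod p) :=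
    ⟨_, fun _ _ => rfl⟩
  -- per-block inverse identities
  have hblk' : ∀ b ∈ blocks, ∀ a c : ℕ, a < b.1.length → c < b.1.length →
      ∑ u ∈ Finset.range b.1.length, A (b.1.getD a 0) (b.2.1.getD u 0) *
        (((b.2.2.getD u []).getD c 0 : ℕ) : ZMod p) = if a = c then 1 else 0 := by
    intro b hb a c ha hc
    obtain ⟨β, hβ, rfl⟩ := List.getElem_of_mem hb
    have h1 := hblk β hβ
    rw [List.getD_eq_getElem _ _ hβ] at h1
    simp only [hA]
    exact blockCheck_entry k p lieZ reps _ _ _ h1 (hblocks _ hb).1.1.2 (hblocks _ hb).1.2 a c ha hc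
  -- cross-block entries vanish: the derivation preserves shapes, distinct blocks have distinct shapes
  have hz : ∀ β β', β < blocks.length → β' < blocks.length → β ≠ β' →
      ∀ i ∈ (blocks.getD β ([], [], [])).1, ∀ c ∈ (blocks.getD β' ([], [], [])).2.1, A i c = 0 := by
    intro β β' hβ hβ' hne i hi c hc
    unfold blockShapesDisjoint at hdisj
    simp only [List.all_eq_true, List.mem_range, Bool.or_eq_true, decide_eq_true_eq] at hdisj
    rcases hdisj β hβ β' hβ' with h1 | h1
    · exact absurd h1 hne
    have hsh := h1 i hi c hc
    have hcm : c ∈ certCols blocks := by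
      rw [certCols, List.mem_flatMap]
      refine ⟨_, ?_, hc⟩
      rw [List.getD_eq_getElem _ _ hβ']
      exact List.getElem_mem _
    unfold colShapePure at hpure
    simp only [List.all_eq_true, decide_eq_true_eq] at hpure
    have hp' := hpure c hcm
    rw [hA, coeffOf_eq_zero_of_ne, Int.cast_zero]
    intro tm htm heq
    have hts := hp' tm htm
    rw [heq] at hts
    exact hsh hts
  have hpw : blocks.Pairwise (fun b b' => (∀ i ∈ b.1, ∀ c ∈ b'.2.1, A i c = 0) ∧
      (∀ i ∈ b'.1, ∀ c ∈ b.2.1, A i c = 0)) := by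
    rw [List.pairwise_iff_getElem]
    intro β β' hβ hβ' hlt
    have e1 : blocks[β] = blocks.getD β ([], [], []) := (List.getD_eq_getElem _ _ hβ).symm
    have e2 : blocks[β'] = blocks.getD β' ([], [], []) := (List.getD_eq_getElem _ _ hβ').symm
    rw [e1, e2]
    exact ⟨hz β β' hβ hβ' (by omega), fun i hi c hc => hz β' β hβ' hβ (by omega) i hi c hc⟩
  -- entry `(s, t)` of the product
  ext s t
  have key := sum_certInvEntry A blocks hlen hblk' hpw s.val t.val s.isLt t.isLt
  have hone : (1 : Matrix (Fin (certRows blocks).length) (Fin (certRows blocks).length) (ZMod p)) s t =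
      if s.val = t.val then 1 else 0 := by
    rw [Matrix.one_apply]
    by_cases h : s = t
    · subst h; simp
    · have h' : s.val ≠ t.val := fun e => h (Fin.ext e)
      simp [h, h']
  rw [hone, ← key, Matrix.mul_apply, Finset.sum_range]
  refine Finset.sum_congr rfl fun u _ => ?_
  -- in-range indices: `certIdx` reads the entries without reduction
  have hu : u.val < (certCols blocks).length := by rw [length_certCols_eq blocks hlen]; exact u.isLt
  have hcu : (certCols blocks).getD u.val 0 < reps.length := by
    have hm : (certCols blocks).getD u.val 0 ∈ certCols blocks := by
      rw [List.getD_eq_getElem _ _ hu]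
      exact List.getElem_mem _
    obtain ⟨b, hb, hc⟩ := List.mem_flatMap.1 hm
    exact (hblocks b hb).1.1.1.2 _ hc
  have hrs : (certRows blocks).getD s.val 0 < (idx k).length := by
    have hm : (certRows blocks).getD s.val 0 ∈ certRows blocks := by
      rw [List.getD_eq_getElem _ _ s.isLt]
      exact List.getElem_mem _
    obtain ⟨b, hb, hi⟩ := List.mem_flatMap.1 hm
    exact (hblocks b hb).1.1.1.1 _ hi
  rw [Matrix.map_apply, Matrix.submatrix_apply, aMatrix, Matrix.of_apply, get_certIdx reps _ _ hJ u [] hcu,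
    get_certIdx (idx k) _ _ hI s [] hrs, certBd, Matrix.of_apply, hA]

end Summit.NavierStokesRegularity.NavierStokesRegularity.Theorems.OddMorawetz
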